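import Summits.MatrixMultiplication.MatrixMultiplication.Theses.LevelGradedCohnUmans

/-!
# `GradedDesignFamily` (crux `stmt-MatrixMultiplication-7610`, route `LevelGradedCohnUmans`):
# the pigeonhole bound for PROPER test spaces (negative-side support)

Support file of the crux disprover (cdisprove seat, cycle 1); everything `sorry`-free.  The crux
asks for a finite group `G`, a bi-invariant `J ≤ ℂ^G` and a `J`-separated triple `X, Y, Z`
beating the GRADED budget `Σ_{χ ∈ Irr ∩ J} χ(1)^(2+ε)`; the whole point of grading is `J ⊊ ℂ^G`.
Proved here, for every finite group:

* `card_image_XY_eq`, `card_image_YZ_eq` — separation makes `(x, y) ↦ x⁻¹y` and `(y, z) ↦ y⁻¹z`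
  injective on `X × Y`, `Y × Z` (so `|X⁻¹Y| = |X||Y|`, `|Y⁻¹Z| = |Y||Z|`);
* `exists_mul_eq_of_card_lt` — pigeonhole in a finite group: `|A| + |B| > |G| ⟹ A·B = G`;
* `single_mem_of_separated_of_card_lt` — if `|X||Y| + |Y||Z| > |G|` then EVERY element of `G` is a
  quadruple product `x⁻¹ y y'⁻¹ z`, so the separating function of a target `(x₀, z₀)` is forced to
  be the delta function `δ_{x₀⁻¹ z₀}` on all of `G`, which therefore lies in `J`;
* `eq_top_of_biInv_of_single_mem` — a bi-invariant `J` containing one delta function contains all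
  of them, hence `J = ⊤`;
* `card_mul_add_card_mul_le_card` — **PIGEONHOLE BOUND FOR GRADED DESIGNS**: for a bi-invariant
  PROPER `J ≠ ⊤` and a `J`-separated triple with `X, Z ≠ ∅`, `|X|·|Y| + |Y|·|Z| ≤ |G|`.
  Graded designs are thus SPARSER than full-budget TPP triples in the same host (which may have
  `|X||Y| + |Y||Z|` up to `2|G|`); together with the graded Neumann count (extremal shape
  `(t, 2t, t)`, `t² = dim J / 3`) a near-extremal proper design needs `dim J ≲ (3/4)|G|`, and in a
  host of order `n` no proper design has `|Y|(|X| + |Z|) > n` — e.g. no `(3, 6, 3)` design in any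
  group of order `< 36`, which empties every non-abelian host of order `≤ 35` for the six-block
  graded cube-beating cell `D = 24, V = 54` (cdisprove census, cycle 1).
-/

noncomputable section

set_option linter.dupNamespace false

open scoped BigOperators

namespace Summit.MatrixMultiplication.MatrixMultiplication.Theorems.GradedDesignFamily.Negative

variable {G : Type} [Group G]

/-- Separation makes `(x, y) ↦ x⁻¹ y` injective on `X × Y` (read the common value against a
target `(x, z₀)`): `|X⁻¹Y| = |X|·|Y|`. [folklore] -/
theorem card_image_XY_eq [DecidableEq G] (J : Set (G → ℂ)) (X Y Z : Finset G)
    (hsep : ∀ x₀ ∈ X, ∀ z₀ ∈ Z, ∃ f ∈ J, ∀ x ∈ X, ∀ y ∈ Y, ∀ y' ∈ Y, ∀ z ∈ Z,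
      (x = x₀ ∧ y = y' ∧ z = z₀ → f (x⁻¹ * y * y'⁻¹ * z) = 1) ∧
      (¬ (x = x₀ ∧ y = y' ∧ z = z₀) → f (x⁻¹ * y * y'⁻¹ * z) = 0))
    (hZ : Z.Nonempty) :
    ((X ×ˢ Y).image fun q : G × G => q.1⁻¹ * q.2).card = X.card * Y.card := by
  obtain ⟨z₀, hz₀⟩ := hZ
  rw [← Finset.card_product]
  refine Finset.card_image_of_injOn ?_
  rintro ⟨x, y⟩ hxy ⟨x', y'⟩ hxy' he
  simp only [Finset.coe_product, Set.mem_prod, Finset.mem_coe] at hxy hxy'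
  simp only at he
  obtain ⟨f, -, hf⟩ := hsep x hxy.1 z₀ hz₀
  have h1 : f (x⁻¹ * y * y⁻¹ * z₀) = 1 := (hf x hxy.1 y hxy.2 y hxy.2 z₀ hz₀).1 ⟨rfl, rfl, rfl⟩
  have he' : x'⁻¹ * y' * y⁻¹ * z₀ = x⁻¹ * y * y⁻¹ * z₀ := by
    rw [show x'⁻¹ * y' * y⁻¹ * z₀ = (x'⁻¹ * y') * (y⁻¹ * z₀) by group, he]; group
  have h2 := (hf x' hxy'.1 y' hxy'.2 y hxy.2 z₀ hz₀).2
  by_contra hne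
  have hne' : ¬ (x' = x ∧ y' = y ∧ z₀ = z₀) := by
    rintro ⟨rfl, rfl, -⟩
    exact hne rfl
  have := h2 hne'
  rw [he', h1] at this
  exact one_ne_zero this

/-- Separation makes `(y, z) ↦ y⁻¹ z` injective on `Y × Z` (read against a target `(x₀, z)`):
`|Y⁻¹Z| = |Y|·|Z|`. [folklore] -/
theorem card_image_YZ_eq [DecidableEq G] (J : Set (G → ℂ)) (X Y Z : Finset G)
    (hsep : ∀ x₀ ∈ X, ∀ z₀ ∈ Z, ∃ f ∈ J, ∀ x ∈ X, ∀ y ∈ Y, ∀ y' ∈ Y, ∀ z ∈ Z,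
      (x = x₀ ∧ y = y' ∧ z = z₀ → f (x⁻¹ * y * y'⁻¹ * z) = 1) ∧
      (¬ (x = x₀ ∧ y = y' ∧ z = z₀) → f (x⁻¹ * y * y'⁻¹ * z) = 0))
    (hX : X.Nonempty) :
    ((Y ×ˢ Z).image fun q : G × G => q.1⁻¹ * q.2).card = Y.card * Z.card := by
  obtain ⟨x₀, hx₀⟩ := hX
  rw [← Finset.card_product]
  refine Finset.card_image_of_injOn ?_
  rintro ⟨y, z⟩ hyz ⟨y', z'⟩ hyz' he
  simp only [Finset.coe_product, Set.mem_prod, Finset.mem_coe] at hyz hyz'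
  simp only at he
  obtain ⟨f, -, hf⟩ := hsep x₀ hx₀ z hyz.2
  have h1 : f (x₀⁻¹ * y * y⁻¹ * z) = 1 := (hf x₀ hx₀ y hyz.1 y hyz.1 z hyz.2).1 ⟨rfl, rfl, rfl⟩
  have he' : x₀⁻¹ * y * y'⁻¹ * z' = x₀⁻¹ * y * y⁻¹ * z := by
    rw [show x₀⁻¹ * y * y'⁻¹ * z' = (x₀⁻¹ * y) * (y'⁻¹ * z') by group, ← he]; group
  have h2 := (hf x₀ hx₀ y hyz.1 y' hyz'.1 z' hyz'.2).2
  by_contra hne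
  have hne' : ¬ (x₀ = x₀ ∧ y = y' ∧ z' = z) := by
    rintro ⟨-, rfl, rfl⟩
    exact hne rfl
  have := h2 hne'
  rw [he', h1] at this
  exact one_ne_zero this

/-- Pigeonhole in a finite group: if `|A| + |B| > |G|` then every `g` is a product `a·b`.
[folklore] -/
theorem exists_mul_eq_of_card_lt [Fintype G] [DecidableEq G] (A B : Finset G)
    (h : Fintype.card G < A.card + B.card) (g : G) : ∃ a ∈ A, ∃ b ∈ B, a * b = g := by
  set A' := A.image fun a => a⁻¹ * g with hA'
  have hcard : A'.card = A.card := by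
    refine Finset.card_image_of_injective _ fun a₁ a₂ h12 => ?_
    simpa using h12
  have hnd : ¬ Disjoint A' B := by
    intro hd
    have := Finset.card_le_univ (A' ∪ B)
    rw [Finset.card_union_of_disjoint hd, hcard] at this
    omega
  obtain ⟨b, hb, hbA⟩ : ∃ b ∈ B, b ∈ A' := by
    simpa [Finset.not_disjoint_iff, and_comm] using hnd
  rw [hA', Finset.mem_image] at hbA
  obtain ⟨a, ha, rfl⟩ := hbA
  exact ⟨a, ha, _, hb, by group⟩

/-- If `|X||Y| + |Y||Z| > |G|` then the separating function of any target `(x₀, z₀)` is the delta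
function `δ_{x₀⁻¹z₀}` on ALL of `G` (every element is a quadruple product), so that delta function
lies in `J`. [folklore] -/
theorem single_mem_of_separated_of_card_lt [Fintype G] [DecidableEq G] (J : Submodule ℂ (G → ℂ))
    (X Y Z : Finset G)
    (hsep : ∀ x₀ ∈ X, ∀ z₀ ∈ Z, ∃ f ∈ J, ∀ x ∈ X, ∀ y ∈ Y, ∀ y' ∈ Y, ∀ z ∈ Z,
      (x = x₀ ∧ y = y' ∧ z = z₀ → f (x⁻¹ * y * y'⁻¹ * z) = 1) ∧
      (¬ (x = x₀ ∧ y = y' ∧ z = z₀) → f (x⁻¹ * y * y'⁻¹ * z) = 0))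
    (hlt : Fintype.card G < X.card * Y.card + Y.card * Z.card)
    {x₀ z₀ : G} (hx₀ : x₀ ∈ X) (hz₀ : z₀ ∈ Z) :
    (Pi.single (x₀⁻¹ * z₀) (1 : ℂ) : G → ℂ) ∈ J := by
  have hsep' : ∀ x₀ ∈ X, ∀ z₀ ∈ Z, ∃ f ∈ (J : Set (G → ℂ)), ∀ x ∈ X, ∀ y ∈ Y, ∀ y' ∈ Y, ∀ z ∈ Z,
      (x = x₀ ∧ y = y' ∧ z = z₀ → f (x⁻¹ * y * y'⁻¹ * z) = 1) ∧
      (¬ (x = x₀ ∧ y = y' ∧ z = z₀) → f (x⁻¹ * y * y'⁻¹ * z) = 0) := hsep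
  rw [← card_image_XY_eq (J : Set (G → ℂ)) X Y Z hsep' ⟨z₀, hz₀⟩,
    ← card_image_YZ_eq (J : Set (G → ℂ)) X Y Z hsep' ⟨x₀, hx₀⟩] at hlt
  obtain ⟨f, hfJ, hf⟩ := hsep x₀ hx₀ z₀ hz₀
  suffices heq : (Pi.single (x₀⁻¹ * z₀) (1 : ℂ) : G → ℂ) = f by rw [heq]; exact hfJ
  funext g
  obtain ⟨a, ha, b, hb, hab⟩ := exists_mul_eq_of_card_lt _ _ hlt g
  rw [Finset.mem_image] at ha hb
  obtain ⟨⟨x, y⟩, hxy, rfl⟩ := ha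
  obtain ⟨⟨y', z⟩, hyz, rfl⟩ := hb
  rw [Finset.mem_product] at hxy hyz
  simp only at hab hxy hyz
  have hg : x⁻¹ * y * y'⁻¹ * z = g := by rw [← hab]; group
  have hval := hf x hxy.1 y hxy.2 y' hyz.1 z hyz.2
  rw [hg] at hval
  by_cases h : g = x₀⁻¹ * z₀
  · subst h
    rw [Pi.single_eq_same]
    -- value `1` from the target quadruple `(x₀, y, y, z₀)`
    have h1 := (hf x₀ hx₀ y hxy.2 y hxy.2 z₀ hz₀).1 ⟨rfl, rfl, rfl⟩
    rw [show x₀⁻¹ * y * y⁻¹ * z₀ = x₀⁻¹ * z₀ by group] at h1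
    exact h1.symm
  · rw [Pi.single_eq_of_ne h]
    refine (hval.2 ?_).symm
    rintro ⟨rfl, rfl, rfl⟩
    exact h (by rw [← hg]; group)

/-- A bi-invariant `J` containing ONE delta function contains all of them, hence is everything.
[folklore] -/
theorem eq_top_of_biInv_of_single_mem [Fintype G] [DecidableEq G] (J : Submodule ℂ (G → ℂ))
    (hJ : ∀ f ∈ J, ∀ a b : G, (fun g : G => f (a * g * b)) ∈ J) {t : G}
    (ht : (Pi.single t (1 : ℂ) : G → ℂ) ∈ J) : J = ⊤ := by
  have hs : ∀ s : G, (Pi.single s (1 : ℂ) : G → ℂ) ∈ J := by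
    intro s
    have h := hJ _ ht 1 (s⁻¹ * t)
    have heq : (fun g : G => (Pi.single t (1 : ℂ) : G → ℂ) (1 * g * (s⁻¹ * t)))
        = (Pi.single s (1 : ℂ) : G → ℂ) := by
      funext g
      by_cases hg : g = s
      · subst hg
        simp
      · have : 1 * g * (s⁻¹ * t) ≠ t := by
          intro h'
          apply hg
          have : g * s⁻¹ = 1 := by
            have h'' : g * s⁻¹ * t = t := by simpa [mul_assoc] using h'
            exact mul_right_cancel (h''.trans (one_mul t).symm)
          exact mul_inv_eq_one.mp this
        rw [Pi.single_eq_of_ne this, Pi.single_eq_of_ne hg]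
    rw [heq] at h
    exact h
  rw [eq_top_iff]
  intro f _
  have hf : f = ∑ s : G, f s • (Pi.single s (1 : ℂ) : G → ℂ) := by
    funext g
    simp [Finset.sum_apply, Pi.single_apply]
  rw [hf]
  exact Submodule.sum_mem _ fun s _ => Submodule.smul_mem _ _ (hs s)

/-- **Pigeonhole bound for graded designs.**  For a finite group `G`, a bi-invariant PROPER test
space `J ≠ ⊤` and a `J`-separated triple with `X, Z ≠ ∅`: `|X|·|Y| + |Y|·|Z| ≤ |G|`.
(Otherwise `X⁻¹Y · Y⁻¹Z = G`, a separating function is a delta function on all of `G`, and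
bi-invariance forces `J = ℂ^G` — the full Cohn–Umans budget, no grading.) [folklore] -/
theorem card_mul_add_card_mul_le_card [Fintype G] (J : Submodule ℂ (G → ℂ))
    (hJ : ∀ f ∈ J, ∀ a b : G, (fun g : G => f (a * g * b)) ∈ J) (hJtop : J ≠ ⊤)
    (X Y Z : Finset G)
    (hsep : ∀ x₀ ∈ X, ∀ z₀ ∈ Z, ∃ f ∈ J, ∀ x ∈ X, ∀ y ∈ Y, ∀ y' ∈ Y, ∀ z ∈ Z,
      (x = x₀ ∧ y = y' ∧ z = z₀ → f (x⁻¹ * y * y'⁻¹ * z) = 1) ∧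
      (¬ (x = x₀ ∧ y = y' ∧ z = z₀) → f (x⁻¹ * y * y'⁻¹ * z) = 0))
    (hX : X.Nonempty) (hZ : Z.Nonempty) :
    X.card * Y.card + Y.card * Z.card ≤ Fintype.card G := by
  classical
  by_contra hlt
  push Not at hlt
  obtain ⟨x₀, hx₀⟩ := hX
  obtain ⟨z₀, hz₀⟩ := hZ
  exact hJtop (eq_top_of_biInv_of_single_mem J hJ
    (single_mem_of_separated_of_card_lt J X Y Z hsep hlt hx₀ hz₀))

/-- Contrapositive, design form: a `J`-separated triple with `|X||Y| + |Y||Z| > |G|` sees the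
FULL budget — every irreducible character lies in `J`. [folklore] -/
theorem irrChars_subset_of_card_lt [Fintype G] (J : Submodule ℂ (G → ℂ))
    (hJ : ∀ f ∈ J, ∀ a b : G, (fun g : G => f (a * g * b)) ∈ J) (X Y Z : Finset G)
    (hsep : ∀ x₀ ∈ X, ∀ z₀ ∈ Z, ∃ f ∈ J, ∀ x ∈ X, ∀ y ∈ Y, ∀ y' ∈ Y, ∀ z ∈ Z,
      (x = x₀ ∧ y = y' ∧ z = z₀ → f (x⁻¹ * y * y'⁻¹ * z) = 1) ∧
      (¬ (x = x₀ ∧ y = y' ∧ z = z₀) → f (x⁻¹ * y * y'⁻¹ * z) = 0))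
    (hX : X.Nonempty) (hZ : Z.Nonempty) (hlt : Fintype.card G < X.card * Y.card + Y.card * Z.card) :
    Literature.RepresentationTheory.FiniteGroups.irrChars G ∩ (J : Set (G → ℂ))
      = Literature.RepresentationTheory.FiniteGroups.irrChars G := by
  have htop : J = ⊤ := by
    by_contra hne
    exact absurd (card_mul_add_card_mul_le_card J hJ hne X Y Z hsep hX hZ) (not_le.2 hlt)
  rw [htop]
  simp

end Summit.MatrixMultiplication.MatrixMultiplication.Theorems.GradedDesignFamily.Negative

end
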